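import Literature.NumberTheory.Sieve.GreenTao2006RestrictionEstimate
import Literature.NumberTheory.Sieve.VinogradovExpSumTools
import Literature.NumberTheory.Sieve.VaughanMeanValueDecomposition
import HarnessLib

/-!
# Pairs of well-spaced points at major-arc differences (Bourgain's counting lemma, log-loss form)

Topic `Literature/NumberTheory/Sieve` (exponential sums; restriction theory). A PROVED tool file
toward `Literature.NumberTheory.DiophantineGeometry.XYZUpperHalf` ([Harper2016, Cor. 1]): Harper's
restriction argument for exponential sums over smooth numbers (op. cit. §4, proof of Proposition 2)
ends with "Harmonic Analysis Result 2" (§2.3, "See pp 305-307 of Bourgain [On `Λ(p)`-subsets of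
squares, Israel J. Math. 67 (1989)]"): for `1/x`-spaced points `θ_1, …, θ_R` and
`G(θ) = ∑_{q ≤ Q} q⁻¹ ∑_{a mod q} 𝟙_{‖θ − a/q‖ ≤ Δ}/(1 + x‖θ − a/q‖)`,
`∑_{r,s} G(θ_r − θ_s) ≪_{ε,A} R Q^ε log(1 + Δx) + R² Q log(1 + Δx)/x + R² log(1 + Δx)/Q^A`.
We PROVE a version with a logarithmic instead of a `Q^ε` loss, which is all that the
log-lossy form of Harper's Theorem 2 used for Corollary 1 needs:

* `sum_sum_majorArcWeight_le` — for `x ≥ 32`, a finite family `θ_i` (`i ∈ T`, `R = #T`) with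
  `|θ_i − θ_j − k| ≥ 1/x` for `i ≠ j`, `k ∈ ℤ`, and any `Q`,
  `∑_{i,j ∈ T} G(θ_i − θ_j) ≤ 1200 (1 + log x)^{23/2} R^{7/6} + 250 (1 + log x) Q R²/x`,
  where `G(θ) = ∑_{q ≤ Q} ∑_{0 ≤ a < q} q⁻¹ (1 + x‖θ − a/q‖)⁻¹` (`majorArcWeight`; no cut-off `Δ`,
  all residues `a` — a majorant of Harper's `G`).

## The argument (Fourier side, finite throughout)

1. *Dyadic positive majorant* (`arcWeight_le_dyadic`): `F(θ) = (1 + x‖θ‖)⁻¹ ≤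
   ∑_{j ≤ J} (8/2^j) M_j⁻² |D_{M_j}(θ)|² + 32/x`, `D_M(θ) = ∑_{m<M} e(mθ)`, `M_j = ⌊x/2^j⌋/8`
   (`|D_M(θ)| ≥ M/2` when `‖θ‖ ≤ 2^j/x`, the tree's positive-kernel bound).
2. *Orthogonality* (`sum_sum_sum_kernel_eq`): `∑_{i,j} ∑_{a mod q} |D_M(θ_i − θ_j − a/q)|² =
   q ∑_{m,m'<M, q ∣ m−m'} |S(m − m')|²`, `S(k) = ∑_i e(kθ_i)`; summing `q⁻¹ ×` this over `q ≤ Q`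
   gives `M Q R² + (off-diagonal) ≤ M Q R² + 2M ∑_{1 ≤ k ≤ M} d(k)|S(k)|²` (`d` = divisor function).
3. *Hölder* with the sixth divisor moment `∑_{k ≤ M} d(k)⁶ ≤ M(1 + log M)^{63}`
   (`sum_card_divisors_pow_le_harmonic`) and the dual large sieve
   `∑_{k ≤ M} |S(k)|² ≤ (M + 1 + 2x) R` (`sum_norm_sq_expSum_le`, from the tree's
   `largeSieve_wellSpaced` by duality): `∑_{k ≤ M} d(k)|S(k)|² ≤ (M(1+log M)^{63})^{1/6}
   (R^{2/5}(M+1+2x)R)^{5/6}`.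
4. Summing over the `J + 1 ≤ log₂ x` scales.

## References

* J. Bourgain, *On `Λ(p)`-subsets of squares*, Israel J. Math. 67 (1989) 291–311, pp. 305–307.
* A. J. Harper, *Minor arcs, mean values, and restriction theory for exponential sums over smooth
  numbers*, Compositio Math. 152 (2016) 1121–1158, §2.3 Harmonic Analysis Result 2, §4
  [Harper2016].
* J. Brüdern, *A problem in additive number theory*, Math. Proc. Cambridge Philos. Soc. 103 (1988)
  27–33, Lemma 2.
-/

noncomputable section

open Finset Real Complex
open scoped ComplexConjugate

namespace Literature.NumberTheory.Sieve

namespace BourgainSpacing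

open LargeSieve (e e_add e_int norm_e conj_e e_zero e_eq_exp e_sub e_nat_mul e_add_int
  largeSieve_wellSpaced)
open Vinogradov (distInt distInt_nonneg distInt_le_half distInt_le_abs_sub_int distInt_neg)
open GreenTao2006 (norm_sq_sum_e_eq_sum_sum sum_sum_offdiag_le e_mul_conj_e)

variable {ι : Type*}

/-! ### The weights -/

/-- `F_x(θ) = 1/(1 + x‖θ‖)`, `‖θ‖` the distance to the nearest integer. [cite: Harper2016, §2.3 (Harmonic Analysis Result 2)] -/
def arcWeight (x t : ℝ) : ℝ := 1 / (1 + x * distInt t)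

/-- `G(θ) = ∑_{q ≤ Q} ∑_{0 ≤ a < q} q⁻¹ F_x(θ − a/q)` (all residues `a`, no cut-off: a majorant of
Harper's `G`). [cite: Harper2016, §2.3 (Harmonic Analysis Result 2)] -/
def majorArcWeight (Q : ℕ) (x t : ℝ) : ℝ :=
  ∑ q ∈ Icc 1 Q, ∑ a ∈ range q, (1 / (q : ℝ)) * arcWeight x (t - a / q)

/-- The exponential sum `S(k) = ∑_i e(k θ_i)` over the points. [folklore] -/
def expSum (T : Finset ι) (θ : ι → ℝ) (k : ℤ) : ℂ := ∑ i ∈ T, e (k * θ i)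

/-- The Dirichlet kernel `D_M(θ) = ∑_{m<M} e(mθ)`. [folklore] -/
def dirichlet (M : ℕ) (t : ℝ) : ℂ := ∑ m ∈ range M, e (m * t)

/-- `F_x ≥ 0`. [folklore] -/
theorem arcWeight_nonneg {x : ℝ} (hx : 0 ≤ x) (t : ℝ) : 0 ≤ arcWeight x t := by
  unfold arcWeight
  have h1 := distInt_nonneg t
  have : 0 ≤ x * distInt t := mul_nonneg hx h1
  positivity

/-- `F_x ≤ 1`. [folklore] -/
theorem arcWeight_le_one {x : ℝ} (hx : 0 ≤ x) (t : ℝ) : arcWeight x t ≤ 1 := by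
  unfold arcWeight
  have h1 : 0 ≤ x * distInt t := mul_nonneg hx (distInt_nonneg t)
  rw [div_le_one (by positivity)]
  linarith

/-- `F_x(θ) ≤ 1/(x‖θ‖)`. [folklore] -/
theorem arcWeight_le_inv {x : ℝ} {t : ℝ} (h : 0 < x * distInt t) :
    arcWeight x t ≤ 1 / (x * distInt t) := by
  unfold arcWeight
  exact one_div_le_one_div_of_le h (by linarith)

/-- `G ≥ 0`. [folklore] -/
theorem majorArcWeight_nonneg (Q : ℕ) {x : ℝ} (hx : 0 ≤ x) (t : ℝ) : 0 ≤ majorArcWeight Q x t := by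
  unfold majorArcWeight
  refine Finset.sum_nonneg fun q _ => Finset.sum_nonneg fun a _ => ?_
  have := arcWeight_nonneg hx (t - a / q)
  positivity

/-! ### The positive kernel: `|D_M(θ)| ≥ M/2` near integers -/

/-- If `z` is within `η` of an integer and `8 M η ≤ 1`, then `|∑_{m<M} e(mz)| ≥ M/2` (all the
phases `2π m (z − m₀)` have size `≤ π/4`; the tree's `half_le_norm_sum_e` with a real window).
[folklore] -/
theorem half_le_norm_dirichlet {M : ℕ} {η : ℝ} (hη : 8 * M * η ≤ 1) {z : ℝ}
    (hz : ∃ m : ℤ, |z - m| ≤ η) : (M : ℝ) / 2 ≤ ‖dirichlet M z‖ := by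
  obtain ⟨m₀, hm₀⟩ := hz
  unfold dirichlet
  set δ := z - m₀ with hδ
  have h1 : ∀ m : ℕ, e (m * z) = e (m * δ) := by
    intro m
    rw [hδ, mul_sub, show (m : ℝ) * z - m * m₀ = m * z + ((-(m * m₀) : ℤ) : ℝ) by push_cast; ring,
      e_add_int]
  simp_rw [h1]
  refine le_trans ?_ (Complex.re_le_norm _)
  rw [Complex.re_sum]
  have h2 : ∀ m ∈ range M, (1 : ℝ) / 2 ≤ (e (m * δ)).re := by
    intro m hm
    rw [Finset.mem_range] at hm
    rw [e_eq_exp, Complex.exp_re]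
    simp only [Complex.mul_re, Complex.I_re, Complex.ofReal_re, zero_mul, Complex.I_im,
      Complex.ofReal_im, mul_zero, sub_zero, Real.exp_zero, one_mul, Complex.mul_im, zero_add]
    have hmM : (m : ℝ) ≤ M := by exact_mod_cast hm.le
    have habs : |2 * π * (m * δ)| ≤ π / 3 := by
      rw [abs_mul, abs_of_pos (by positivity : (0 : ℝ) < 2 * π), abs_mul,
        abs_of_nonneg (Nat.cast_nonneg m)]
      have hmδ : (m : ℝ) * |δ| ≤ M * η := mul_le_mul hmM hm₀ (abs_nonneg _) (Nat.cast_nonneg M)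
      have : (M : ℝ) * η ≤ 1 / 8 := by linarith
      nlinarith [Real.pi_pos, abs_nonneg δ]
    rw [← Real.cos_abs, ← Real.cos_pi_div_three]
    exact Real.cos_le_cos_of_nonneg_of_le_pi (abs_nonneg _) (by linarith [Real.pi_pos]) habs
  calc (M : ℝ) / 2 = ∑ m ∈ range M, (1 : ℝ) / 2 := by simp; ring
    _ ≤ ∑ m ∈ range M, (e (m * δ)).re := Finset.sum_le_sum h2

/-! ### The dyadic majorant of `F_x` -/

/-- The kernel length at scale `j`: `M_j = ⌊x/2^j⌋/8`. [folklore] -/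
def scaleLen (x : ℝ) (j : ℕ) : ℕ := ⌊x / 2 ^ j⌋₊ / 8

/-- `M_j ≤ x/2^j/8`. [folklore] -/
theorem scaleLen_le (x : ℝ) (hx : 0 ≤ x) (j : ℕ) : (scaleLen x j : ℝ) ≤ x / 2 ^ j / 8 := by
  unfold scaleLen
  calc ((⌊x / 2 ^ j⌋₊ / 8 : ℕ) : ℝ) ≤ (⌊x / 2 ^ j⌋₊ : ℝ) / 8 := Nat.cast_div_le
    _ ≤ x / 2 ^ j / 8 := by gcongr; exact Nat.floor_le (by positivity)

/-- At the scales `j` with `x/2^j ≥ 16`: `1 ≤ M_j` and `x/2^{j+4} ≤ M_j`. [folklore] -/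
theorem le_scaleLen {x : ℝ} {j : ℕ} (h : 16 ≤ x / 2 ^ j) :
    1 ≤ scaleLen x j ∧ x / 2 ^ j / 16 ≤ (scaleLen x j : ℝ) := by
  unfold scaleLen
  have hfl : x / 2 ^ j - 1 ≤ (⌊x / 2 ^ j⌋₊ : ℝ) := by
    have := Nat.lt_floor_add_one (x / 2 ^ j); linarith
  have h8 : ((⌊x / 2 ^ j⌋₊ : ℝ) - 7) / 8 ≤ ((⌊x / 2 ^ j⌋₊ / 8 : ℕ) : ℝ) := by
    have h1 : (⌊x / 2 ^ j⌋₊ : ℝ) ≤ 8 * ((⌊x / 2 ^ j⌋₊ / 8 : ℕ) : ℝ) + 7 := by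
      have := Nat.div_add_mod ⌊x / 2 ^ j⌋₊ 8
      have hmod := Nat.mod_lt ⌊x / 2 ^ j⌋₊ (by norm_num : 0 < 8)
      have : (⌊x / 2 ^ j⌋₊ : ℝ) = 8 * ((⌊x / 2 ^ j⌋₊ / 8 : ℕ) : ℝ) + ((⌊x / 2 ^ j⌋₊ % 8 : ℕ) : ℝ) := by
        exact_mod_cast this.symm
      have hmod' : ((⌊x / 2 ^ j⌋₊ % 8 : ℕ) : ℝ) ≤ 7 := by
        exact_mod_cast Nat.lt_succ_iff.mp hmod
      linarith
    linarith
  constructor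
  · have : (1 : ℝ) ≤ ((⌊x / 2 ^ j⌋₊ / 8 : ℕ) : ℝ) := by linarith
    exact_mod_cast this
  · linarith

/-- **The dyadic positive majorant.** For `x ≥ 32` and `J` with `x/32 ≤ 2^J ≤ x/16`:
`F_x(θ) ≤ ∑_{j ≤ J} (8/2^j) M_j⁻² |D_{M_j}(θ)|² + 32/x` for every real `θ`. (For `x‖θ‖ > 2^J`,
`F_x(θ) < 32/x`; otherwise take the least `j` with `x‖θ‖ ≤ 2^j`: then `F_x(θ) ≤ 2^{1−j}` while
`|D_{M_j}(θ)| ≥ M_j/2` as `8 M_j · 2^j/x ≤ 1`.) [folklore] -/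
theorem arcWeight_le_dyadic {x : ℝ} (hx : 32 ≤ x) {J : ℕ} (hJlo : x / 32 ≤ 2 ^ J)
    (hJhi : (2 : ℝ) ^ J ≤ x / 16) (t : ℝ) :
    arcWeight x t ≤
      ∑ j ∈ range (J + 1), (8 / 2 ^ j / (scaleLen x j : ℝ) ^ 2) * ‖dirichlet (scaleLen x j) t‖ ^ 2 +
        32 / x := by
  have hx0 : 0 < x := by linarith
  have hterm : ∀ j ∈ range (J + 1),
      0 ≤ (8 / 2 ^ j / (scaleLen x j : ℝ) ^ 2) * ‖dirichlet (scaleLen x j) t‖ ^ 2 :=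
    fun j _ => by positivity
  have hsum0 := Finset.sum_nonneg hterm
  set u : ℝ := x * distInt t with hu
  have hu0 : 0 ≤ u := by rw [hu]; have := distInt_nonneg t; positivity
  by_cases hbig : (2 : ℝ) ^ J < u
  · -- far from all integers: `F < 32/x`
    have hupos : 0 < u := lt_of_le_of_lt (by positivity) hbig
    have h1 : arcWeight x t ≤ 1 / u := arcWeight_le_inv (by rwa [hu] at hupos)
    have h2 : 1 / u ≤ 32 / x := by
      rw [div_le_div_iff₀ hupos hx0]
      have : x / 32 < u := lt_of_le_of_lt hJlo hbig
      rw [div_lt_iff₀ (by norm_num : (0 : ℝ) < 32)] at this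
      linarith
    linarith
  · push Not at hbig
    -- the least scale `j₀` with `u ≤ 2^{j₀}`
    have hex : ∃ j : ℕ, u ≤ 2 ^ j := ⟨J, hbig⟩
    classical
    set j₀ := Nat.find hex with hj₀
    have hj₀u : u ≤ 2 ^ j₀ := Nat.find_spec hex
    have hj₀J : j₀ ≤ J := Nat.find_min' hex hbig
    have hj₀mem : j₀ ∈ range (J + 1) := Finset.mem_range.mpr (Nat.lt_succ_of_le hj₀J)
    -- the scale facts
    have hscale : 16 ≤ x / 2 ^ j₀ := by
      rw [le_div_iff₀ (by positivity)]
      calc 16 * (2 : ℝ) ^ j₀ ≤ 16 * 2 ^ J := by gcongr; norm_num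
        _ ≤ x := by rw [← le_div_iff₀' (by norm_num : (0 : ℝ) < 16)]; exact hJhi
    obtain ⟨hM1, hMlo⟩ := le_scaleLen hscale
    have hMhi := scaleLen_le x hx0.le j₀
    set M := scaleLen x j₀ with hM
    have hM0 : (0 : ℝ) < M := by exact_mod_cast hM1
    -- `F ≤ 2^{1-j₀}`
    have hF : arcWeight x t ≤ 2 / 2 ^ j₀ := by
      rcases Nat.eq_zero_or_pos j₀ with hz | hpos
      · rw [hz, pow_zero, div_one]
        exact (arcWeight_le_one hx0.le t).trans (by norm_num)
      · have hmin : ¬ u ≤ 2 ^ (j₀ - 1) := Nat.find_min hex (by omega)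
        push Not at hmin
        have hupos : 0 < u := lt_of_le_of_lt (by positivity) hmin
        have h1 : arcWeight x t ≤ 1 / u := arcWeight_le_inv (by rwa [hu] at hupos)
        refine h1.trans ?_
        rw [div_le_div_iff₀ hupos (by positivity)]
        have : (2 : ℝ) ^ j₀ = 2 * 2 ^ (j₀ - 1) := by
          rw [← pow_succ']; congr 1; omega
        rw [this]; linarith
    -- `|D_M(t)| ≥ M/2`
    have hD : (M : ℝ) / 2 ≤ ‖dirichlet M t‖ := by
      refine half_le_norm_dirichlet (η := 2 ^ j₀ / x) ?_ ⟨round t, ?_⟩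
      · calc 8 * (M : ℝ) * (2 ^ j₀ / x) ≤ 8 * (x / 2 ^ j₀ / 8) * (2 ^ j₀ / x) := by gcongr
          _ = 1 := by field_simp
      · have : distInt t ≤ 2 ^ j₀ / x := by
          rw [le_div_iff₀ hx0]; rw [hu] at hj₀u; linarith
        exact this
    -- the `j₀`-th term alone dominates `F`
    have hkey : arcWeight x t ≤ (8 / 2 ^ j₀ / (M : ℝ) ^ 2) * ‖dirichlet M t‖ ^ 2 := by
      refine hF.trans ?_
      have hsq : ((M : ℝ) / 2) ^ 2 ≤ ‖dirichlet M t‖ ^ 2 := pow_le_pow_left₀ (by positivity) hD 2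
      calc (2 : ℝ) / 2 ^ j₀ = (8 / 2 ^ j₀ / (M : ℝ) ^ 2) * ((M : ℝ) / 2) ^ 2 := by
            field_simp; ring
        _ ≤ (8 / 2 ^ j₀ / (M : ℝ) ^ 2) * ‖dirichlet M t‖ ^ 2 :=
            mul_le_mul_of_nonneg_left hsq (by positivity)
    calc arcWeight x t ≤ (8 / 2 ^ j₀ / (M : ℝ) ^ 2) * ‖dirichlet M t‖ ^ 2 := hkey
      _ ≤ ∑ j ∈ range (J + 1), (8 / 2 ^ j / (scaleLen x j : ℝ) ^ 2) * ‖dirichlet (scaleLen x j) t‖ ^ 2 :=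
          Finset.single_le_sum hterm hj₀mem
      _ ≤ _ := by linarith [div_nonneg (by norm_num : (0 : ℝ) ≤ 32) hx0.le]

/-- Existence of the dyadic range: for `x ≥ 32` there is `J` with `x/32 ≤ 2^J ≤ x/16` and
`J ≤ log x / log 2`. [folklore] -/
theorem exists_dyadic_range {x : ℝ} (hx : 32 ≤ x) :
    ∃ J : ℕ, x / 32 ≤ 2 ^ J ∧ (2 : ℝ) ^ J ≤ x / 16 ∧ (J : ℝ) ≤ Real.log x / Real.log 2 := by
  -- `J = ⌊log₂ (x/16)⌋`
  have hx16 : 1 ≤ x / 16 := by rw [le_div_iff₀ (by norm_num)]; linarith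
  set L : ℝ := Real.logb 2 (x / 16) with hL
  have hL0 : 0 ≤ L := Real.logb_nonneg (by norm_num) hx16
  refine ⟨⌊L⌋₊, ?_, ?_, ?_⟩
  · have h1 : L < ⌊L⌋₊ + 1 := Nat.lt_floor_add_one L
    have h2 : x / 16 < 2 ^ ((⌊L⌋₊ : ℝ) + 1) := by
      have : x / 16 = 2 ^ L := by rw [hL, Real.rpow_logb (by norm_num) (by norm_num) (by linarith)]
      rw [this]
      exact Real.rpow_lt_rpow_of_exponent_lt (by norm_num) h1
    rw [Real.rpow_add (by norm_num), Real.rpow_natCast, Real.rpow_one] at h2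
    linarith
  · have h1 : (⌊L⌋₊ : ℝ) ≤ L := Nat.floor_le hL0
    calc (2 : ℝ) ^ ⌊L⌋₊ = 2 ^ ((⌊L⌋₊ : ℝ)) := (Real.rpow_natCast _ _).symm
      _ ≤ 2 ^ L := Real.rpow_le_rpow_of_exponent_le (by norm_num) h1
      _ = x / 16 := by rw [hL, Real.rpow_logb (by norm_num) (by norm_num) (by linarith)]
  · have h1 : (⌊L⌋₊ : ℝ) ≤ L := Nat.floor_le hL0
    have h2 : L ≤ Real.logb 2 x := Real.logb_le_logb_of_le (by norm_num) (by linarith) (by linarith)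
    rw [Real.logb] at h2
    linarith

/-! ### Orthogonality: summing the kernel over `a mod q` and over the pairs -/

/-- `S(−k) = conj S(k)`, so `‖S(−k)‖ = ‖S(k)‖`. [folklore] -/
theorem norm_expSum_neg (T : Finset ι) (θ : ι → ℝ) (k : ℤ) :
    ‖expSum T θ (-k)‖ = ‖expSum T θ k‖ := by
  unfold expSum
  rw [show (∑ i ∈ T, e (((-k : ℤ) : ℝ) * θ i)) = conj (∑ i ∈ T, e ((k : ℝ) * θ i)) by
    rw [map_sum]; refine Finset.sum_congr rfl fun i _ => ?_
    rw [conj_e]; congr 1; push_cast; ring]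
  exact Complex.norm_conj _

/-- `S(0) = #T`. [folklore] -/
theorem expSum_zero (T : Finset ι) (θ : ι → ℝ) : expSum T θ 0 = (T.card : ℂ) := by
  unfold expSum
  simp [e_zero]

/-- `‖S(k)‖ ≤ #T`. [folklore] -/
theorem norm_expSum_le (T : Finset ι) (θ : ι → ℝ) (k : ℤ) : ‖expSum T θ k‖ ≤ T.card := by
  unfold expSum
  calc ‖∑ i ∈ T, e ((k : ℝ) * θ i)‖ ≤ ∑ i ∈ T, ‖e ((k : ℝ) * θ i)‖ := norm_sum_le _ _
    _ = T.card := by simp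

/-- `∑_{i,j ∈ T} e(k(θ_i − θ_j)) = |S(k)|²`. [folklore] -/
theorem sum_sum_e_sub_eq (T : Finset ι) (θ : ι → ℝ) (k : ℤ) :
    ∑ i ∈ T, ∑ j ∈ T, e ((k : ℝ) * (θ i - θ j)) = ((‖expSum T θ k‖ ^ 2 : ℝ) : ℂ) := by
  unfold expSum
  push_cast
  rw [← Complex.mul_conj', map_sum, Finset.sum_mul_sum]
  refine Finset.sum_congr rfl fun i _ => Finset.sum_congr rfl fun j _ => ?_
  rw [e_mul_conj_e]; congr 1; ring

/-- **Orthogonality.** For `q ≥ 1`, `M`, and any points: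
`∑_{(i,j),a} |D_M(θ_i − θ_j − a/q)|² = q ∑_{(m,m'), q ∣ m − m'} |S(m − m')|²`
(`0 ≤ a < q`, `m, m' < M`; as real numbers). [cite: Harper2016, §2.3 (Harmonic Analysis Result 2)] -/
theorem sum_kernel_prod_eq (T : Finset ι) (θ : ι → ℝ) {q : ℕ} (hq : q ≠ 0) (M : ℕ) :
    ∑ σ ∈ (T ×ˢ T) ×ˢ range q, ‖dirichlet M (θ σ.1.1 - θ σ.1.2 - (σ.2 : ℝ) / q)‖ ^ 2 =
      q * ∑ μ ∈ range M ×ˢ range M,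
        (if (q : ℤ) ∣ ((μ.1 : ℤ) - μ.2) then ‖expSum T θ ((μ.1 : ℤ) - μ.2)‖ ^ 2 else 0) := by
  classical
  have key : ∀ z : ℝ, ((‖dirichlet M z‖ ^ 2 : ℝ) : ℂ) =
      ∑ μ ∈ range M ×ˢ range M, e (((μ.1 : ℝ) - μ.2) * z) := fun z =>
    GreenTao2006.norm_sq_sum_e_eq_sum_prod M z
  apply Complex.ofReal_injective
  rw [Complex.ofReal_sum, Complex.ofReal_mul, Complex.ofReal_natCast, Complex.ofReal_sum]
  simp_rw [key]
  rw [Finset.sum_comm, Finset.mul_sum]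
  refine Finset.sum_congr rfl fun μ _ => ?_
  set k : ℤ := (μ.1 : ℤ) - μ.2 with hk
  have hkr : ((μ.1 : ℝ) - μ.2) = (k : ℝ) := by rw [hk]; push_cast; ring
  have h2 : ∀ σ : (ι × ι) × ℕ, e (((μ.1 : ℝ) - μ.2) * (θ σ.1.1 - θ σ.1.2 - (σ.2 : ℝ) / q)) =
      e ((k : ℝ) * (θ σ.1.1 - θ σ.1.2)) * e ((σ.2 : ℝ) * ((-k : ℤ) : ℝ) / q) := by
    intro σ
    rw [← e_add, hkr]; congr 1; push_cast; ring
  simp_rw [h2]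
  rw [Finset.sum_product]
  dsimp only
  rw [← Finset.sum_mul_sum, Finset.sum_product]
  dsimp only
  rw [sum_sum_e_sub_eq T θ k, RamanujanSum.sum_range_fourierChar_div hq (-k)]
  simp only [dvd_neg]
  split_ifs with hd
  · push_cast; ring
  · simp

/-- The number of `q ≤ Q` dividing `k`. [folklore] -/
def divCount (Q : ℕ) (k : ℤ) : ℕ := ((Icc 1 Q).filter fun q : ℕ => (q : ℤ) ∣ k).card

/-- Every `q` divides `0`: `d_Q(0) = Q`. [folklore] -/
theorem divCount_zero (Q : ℕ) : divCount Q 0 = Q := by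
  unfold divCount
  rw [Finset.filter_true_of_mem fun q _ => dvd_zero _]
  simp

/-- For `k ≠ 0`, `#{q ≤ Q : q ∣ k} ≤ d(|k|)`. [folklore] -/
theorem divCount_le_card_divisors (Q : ℕ) {k : ℤ} (hk : k ≠ 0) :
    divCount Q k ≤ (k.natAbs).divisors.card := by
  unfold divCount
  refine Finset.card_le_card_of_injOn id (fun q hq => ?_) (Set.injOn_id _)
  rw [Finset.mem_coe, Finset.mem_filter, Finset.mem_Icc] at hq
  rw [id, Finset.mem_coe, Nat.mem_divisors]
  refine ⟨?_, Int.natAbs_ne_zero.mpr hk⟩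
  exact Int.natCast_dvd.mp hq.2

/-- **Summing `q⁻¹ ×` the orthogonality identity over `q ≤ Q`**:
`∑_{q ≤ Q} ∑_{(i,j),a} q⁻¹ |D_M(θ_i − θ_j − a/q)|² = ∑_{(m,m')} d_Q(m − m') |S(m − m')|²`.
[cite: Harper2016, §2.3 (Harmonic Analysis Result 2)] -/
theorem sum_sum_kernel_eq_divCount (T : Finset ι) (θ : ι → ℝ) (Q M : ℕ) :
    ∑ q ∈ Icc 1 Q, ∑ σ ∈ (T ×ˢ T) ×ˢ range q,
        (1 / (q : ℝ)) * ‖dirichlet M (θ σ.1.1 - θ σ.1.2 - (σ.2 : ℝ) / q)‖ ^ 2 =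
      ∑ μ ∈ range M ×ˢ range M, (divCount Q ((μ.1 : ℤ) - μ.2) : ℝ) *
        ‖expSum T θ ((μ.1 : ℤ) - μ.2)‖ ^ 2 := by
  classical
  have h1 : ∀ q ∈ Icc 1 Q, ∑ σ ∈ (T ×ˢ T) ×ˢ range q,
      (1 / (q : ℝ)) * ‖dirichlet M (θ σ.1.1 - θ σ.1.2 - (σ.2 : ℝ) / q)‖ ^ 2 =
      ∑ μ ∈ range M ×ˢ range M,
        (if (q : ℤ) ∣ ((μ.1 : ℤ) - μ.2) then ‖expSum T θ ((μ.1 : ℤ) - μ.2)‖ ^ 2 else 0) := by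
    intro q hq
    rw [Finset.mem_Icc] at hq
    have hq0 : q ≠ 0 := by omega
    have hq0' : (q : ℝ) ≠ 0 := by exact_mod_cast hq0
    rw [← Finset.mul_sum, sum_kernel_prod_eq T θ hq0 M, ← mul_assoc, one_div_mul_cancel hq0', one_mul]
  rw [Finset.sum_congr rfl h1, Finset.sum_comm]
  refine Finset.sum_congr rfl fun μ _ => ?_
  rw [← Finset.sum_filter, Finset.sum_const, nsmul_eq_mul]
  rfl

/-- **Diagonal and off-diagonal.** `∑_{(m,m')} d_Q(m − m') |S(m − m')|² ≤
M Q R² + 2M ∑_{1 ≤ n ≤ M} d(n) |S(n)|²` (`m, m' < M`, `R = #T`). [folklore] -/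
theorem sum_divCount_mul_le (T : Finset ι) (θ : ι → ℝ) (Q M : ℕ) :
    ∑ μ ∈ range M ×ˢ range M, (divCount Q ((μ.1 : ℤ) - μ.2) : ℝ) *
        ‖expSum T θ ((μ.1 : ℤ) - μ.2)‖ ^ 2 ≤
      M * Q * (T.card : ℝ) ^ 2 + 2 * M * ∑ n ∈ Icc 1 M,
        ((n.divisors.card : ℝ) * ‖expSum T θ n‖ ^ 2) := by
  classical
  set h : ℕ → ℝ := fun n => (n.divisors.card : ℝ) * ‖expSum T θ n‖ ^ 2 with hh
  have hh0 : ∀ n, 0 ≤ h n := fun n => by positivity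
  -- pointwise: diagonal term or off-diagonal bound
  have hpt : ∀ μ ∈ range M ×ˢ range M,
      (divCount Q ((μ.1 : ℤ) - μ.2) : ℝ) * ‖expSum T θ ((μ.1 : ℤ) - μ.2)‖ ^ 2 ≤
        (if μ.1 = μ.2 then (Q : ℝ) * (T.card : ℝ) ^ 2 else 0) +
        (if μ.1 = μ.2 then 0 else h (((μ.1 : ℤ) - μ.2).natAbs)) := by
    intro μ _
    by_cases hd : μ.1 = μ.2
    · rw [if_pos hd, if_pos hd, add_zero, hd, sub_self, divCount_zero, expSum_zero]
      simp
    · rw [if_neg hd, if_neg hd, zero_add, hh]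
      dsimp only
      have hk : ((μ.1 : ℤ) - μ.2) ≠ 0 := by omega
      have h1 : (divCount Q ((μ.1 : ℤ) - μ.2) : ℝ) ≤ ((((μ.1 : ℤ) - μ.2).natAbs).divisors.card : ℝ) := by
        exact_mod_cast divCount_le_card_divisors Q hk
      have h2 : ‖expSum T θ ((μ.1 : ℤ) - μ.2)‖ = ‖expSum T θ ((((μ.1 : ℤ) - μ.2).natAbs : ℕ) : ℤ)‖ := by
        rcases Int.natAbs_eq ((μ.1 : ℤ) - μ.2) with h | h
        · rw [← h]
        · conv_lhs => rw [h]
          rw [norm_expSum_neg]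
      rw [h2]
      exact mul_le_mul_of_nonneg_right h1 (by positivity)
  refine (Finset.sum_le_sum hpt).trans ?_
  rw [Finset.sum_add_distrib]
  refine add_le_add ?_ ?_
  · -- diagonal
    rw [Finset.sum_product]
    have : ∀ m ∈ range M, ∑ m' ∈ range M,
        (if (m, m').1 = (m, m').2 then (Q : ℝ) * (T.card : ℝ) ^ 2 else 0) = (Q : ℝ) * (T.card : ℝ) ^ 2 := by
      intro m hm
      simp only
      rw [Finset.sum_ite_eq (range M) m]
      rw [if_pos hm]
    rw [Finset.sum_congr rfl this, Finset.sum_const, Finset.card_range, nsmul_eq_mul]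
    ring_nf
    rfl
  · rw [Finset.sum_product]
    exact GreenTao2006.sum_sum_offdiag_le h hh0

/-! ### The dual large sieve -/

/-- **Dual large sieve**: for `1/x`-spaced points (`|θ_i − θ_j − k| ≥ 1/x`, `i ≠ j`, `k ∈ ℤ`),
`∑_{1 ≤ n ≤ M} |S(n)|² ≤ (M + 1 + 2x) R` (duality from the tree's `largeSieve_wellSpaced`).
[folklore] -/
theorem sum_norm_sq_expSum_le (T : Finset ι) (θ : ι → ℝ) {x : ℝ} (hx : 0 < x)
    (hsep : ∀ i ∈ T, ∀ j ∈ T, i ≠ j → ∀ k : ℤ, 1 / x ≤ |θ j - θ i - k|) (M : ℕ) :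
    ∑ n ∈ Icc 1 M, ‖expSum T θ n‖ ^ 2 ≤ ((M : ℝ) + 1 + 2 * x) * T.card := by
  classical
  -- pass to `n ∈ Ioc 0 M` in `ℤ`
  have hIcc : ∑ n ∈ Icc 1 M, ‖expSum T θ n‖ ^ 2 = ∑ n ∈ Ioc (0 : ℤ) (0 + M), ‖expSum T θ n‖ ^ 2 := by
    rw [zero_add]
    have : (Ioc (0 : ℤ) M) = (Icc 1 M).map Nat.castEmbedding := by
      ext n
      simp only [Finset.mem_Ioc, Finset.mem_map, Finset.mem_Icc, Nat.castEmbedding_apply]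
      constructor
      · rintro ⟨h1, h2⟩
        refine ⟨n.toNat, ⟨by omega, by omega⟩, by omega⟩
      · rintro ⟨m, ⟨h1, h2⟩, rfl⟩; omega
    rw [this, Finset.sum_map]
    rfl
  rw [hIcc]
  set V : ℝ := ∑ n ∈ Ioc (0 : ℤ) (0 + M), ‖expSum T θ n‖ ^ 2 with hV
  have hV0 : 0 ≤ V := Finset.sum_nonneg fun n _ => by positivity
  set a : ℤ → ℂ := fun n => conj (expSum T θ n) with ha
  -- large sieve for `a`
  have hLS := largeSieve_wellSpaced (R := T) (x := θ) (one_div_pos.mpr hx) hsep a 0 M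
  rw [div_div_eq_mul_div, div_one] at hLS
  have ha2 : ∑ n ∈ Ioc (0 : ℤ) (0 + M), ‖a n‖ ^ 2 = V := by
    simp only [ha, Complex.norm_conj, hV]
  rw [ha2] at hLS
  -- `V = ∑_r B_r` with `B_r = ∑_n a_n e(n θ_r)`
  set B : ι → ℂ := fun r => ∑ n ∈ Ioc (0 : ℤ) (0 + M), a n * e (n * θ r) with hB
  have hVB : (V : ℂ) = ∑ r ∈ T, B r := by
    rw [hV, Complex.ofReal_sum]
    have : ∀ n ∈ Ioc (0 : ℤ) (0 + M), ((‖expSum T θ n‖ ^ 2 : ℝ) : ℂ) =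
        ∑ r ∈ T, a n * e (n * θ r) := by
      intro n _
      have han : a n = conj (expSum T θ n) := by rw [ha]
      rw [han]
      push_cast
      rw [← Complex.mul_conj']
      unfold expSum
      rw [Finset.sum_mul]
      refine Finset.sum_congr rfl fun r _ => ?_
      ring
    rw [Finset.sum_congr rfl this, Finset.sum_comm]
  -- Cauchy–Schwarz: `V ≤ ∑_r ‖B_r‖ ≤ √R √(∑ ‖B_r‖²)`
  have h1 : V ≤ ∑ r ∈ T, ‖B r‖ := by
    have : V = ‖(V : ℂ)‖ := by rw [Complex.norm_real, Real.norm_of_nonneg hV0]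
    rw [this, hVB]
    exact norm_sum_le _ _
  have h2 : (∑ r ∈ T, ‖B r‖) ^ 2 ≤ T.card * ∑ r ∈ T, ‖B r‖ ^ 2 := by
    have := sq_sum_le_card_mul_sum_sq (s := T) (f := fun r => ‖B r‖)
    exact this
  have h3 : V ^ 2 ≤ T.card * (((M : ℝ) + 1 + 2 * x) * V) := by
    calc V ^ 2 ≤ (∑ r ∈ T, ‖B r‖) ^ 2 := pow_le_pow_left₀ hV0 h1 2
      _ ≤ T.card * ∑ r ∈ T, ‖B r‖ ^ 2 := h2
      _ ≤ T.card * (((M : ℝ) + 1 + 2 * x) * V) := mul_le_mul_of_nonneg_left hLS (Nat.cast_nonneg _)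
  rcases hV0.lt_or_eq with hVpos | hV0'
  · have : V * V ≤ (((M : ℝ) + 1 + 2 * x) * T.card) * V := by nlinarith
    exact le_of_mul_le_mul_right this hVpos
  · rw [← hV0']; positivity

/-! ### Divisor moments -/

/-- **Divisor moments by iterated Cauchy products**: for all `m` and `N`,
`∑_{n ≤ N} d(n)^m/n ≤ (1 + log N)^{2^m}` and `∑_{n ≤ N} d(n)^m ≤ N (1 + log N)^{2^m − 1}`.
[folklore] -/
theorem sum_card_divisors_pow_le_harmonic (m N : ℕ) :
    ∑ n ∈ Ioc 0 N, ((n.divisors.card : ℝ) ^ m / n) ≤ (1 + Real.log N) ^ (2 ^ m) ∧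
    ∑ n ∈ Ioc 0 N, (n.divisors.card : ℝ) ^ m ≤ N * (1 + Real.log N) ^ (2 ^ m - 1) := by
  induction m generalizing N with
  | zero =>
    simp only [pow_zero, one_div, pow_one, Nat.sub_self, mul_one, Finset.sum_const,
      Nat.card_Ioc, Nat.sub_zero, nsmul_eq_mul]
    exact ⟨Vaughan.sum_Ioc_inv_le N, le_rfl⟩
  | succ m ih =>
    have hlog : 0 ≤ 1 + Real.log N := by
      rcases Nat.eq_zero_or_pos N with h | h
      · simp [h]
      · have : (1 : ℝ) ≤ N := by exact_mod_cast h
        linarith [Real.log_nonneg this]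
    -- the expansion `d(n)^{m+1} = ∑_{ab = n} d(ab)^m ≤ ∑_{ab=n} d(a)^m d(b)^m`
    have hexp : ∀ (w : ℕ → ℝ), (∀ n, 0 ≤ w n) →
        ∑ n ∈ Ioc 0 N, (n.divisors.card : ℝ) ^ (m + 1) * w n ≤
          ∑ a ∈ Ioc 0 N, ∑ b ∈ Ioc 0 (N / a),
            ((a.divisors.card : ℝ) ^ m * (b.divisors.card : ℝ) ^ m * w (a * b)) := by
      intro w hw
      rw [← Vaughan.sum_Ioc_sum_divisorsAntidiagonal_eq
        (fun a b => (a.divisors.card : ℝ) ^ m * (b.divisors.card : ℝ) ^ m * w (a * b)) N]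
      refine Finset.sum_le_sum fun n hn => ?_
      rw [pow_succ, mul_assoc]
      nth_rw 2 [Vaughan.card_divisors_eq_sum_antidiagonal n]
      rw [Finset.sum_mul, Finset.mul_sum]
      refine Finset.sum_le_sum fun x hx => ?_
      rw [Nat.mem_divisorsAntidiagonal] at hx
      obtain ⟨hxn, -⟩ := hx
      rw [hxn, one_mul]
      have h1 : (n.divisors.card : ℝ) ≤ (x.1.divisors.card : ℝ) * x.2.divisors.card := by
        rw [← hxn]; exact_mod_cast Vaughan.card_divisors_mul_le x.1 x.2
      calc (n.divisors.card : ℝ) ^ m * w n ≤ ((x.1.divisors.card : ℝ) * x.2.divisors.card) ^ m * w n :=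
            mul_le_mul_of_nonneg_right (pow_le_pow_left₀ (Nat.cast_nonneg _) h1 m) (hw n)
        _ = _ := by rw [mul_pow]
    obtain ⟨ihP, -⟩ := ih N
    constructor
    · -- the weighted sum
      have hw : ∀ n : ℕ, (0 : ℝ) ≤ 1 / n := fun n => by positivity
      have h1 := hexp (fun n => 1 / (n : ℝ)) hw
      simp only [mul_one_div] at h1
      refine h1.trans ?_
      calc ∑ a ∈ Ioc 0 N, ∑ b ∈ Ioc 0 (N / a),
            (a.divisors.card : ℝ) ^ m * (b.divisors.card : ℝ) ^ m / ((a * b : ℕ) : ℝ)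
          ≤ ∑ a ∈ Ioc 0 N, ∑ b ∈ Ioc 0 N,
            (a.divisors.card : ℝ) ^ m * (b.divisors.card : ℝ) ^ m / ((a * b : ℕ) : ℝ) := by
            refine Finset.sum_le_sum fun a ha => ?_
            refine Finset.sum_le_sum_of_subset_of_nonneg (Finset.Ioc_subset_Ioc_right
              (Nat.div_le_self N a)) fun b _ _ => by positivity
        _ = (∑ a ∈ Ioc 0 N, (a.divisors.card : ℝ) ^ m / a) *
              (∑ b ∈ Ioc 0 N, (b.divisors.card : ℝ) ^ m / b) := by
            rw [Finset.sum_mul_sum]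
            refine Finset.sum_congr rfl fun a ha => Finset.sum_congr rfl fun b hb => ?_
            have ha0 : (a : ℝ) ≠ 0 := by have := (Finset.mem_Ioc.mp ha).1; positivity
            have hb0 : (b : ℝ) ≠ 0 := by have := (Finset.mem_Ioc.mp hb).1; positivity
            push_cast
            field_simp
        _ ≤ (1 + Real.log N) ^ (2 ^ m) * (1 + Real.log N) ^ (2 ^ m) := by
            have h0 : 0 ≤ ∑ a ∈ Ioc 0 N, (a.divisors.card : ℝ) ^ m / a :=
              Finset.sum_nonneg fun a _ => by positivity
            exact mul_le_mul ihP ihP h0 (pow_nonneg hlog _)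
        _ = (1 + Real.log N) ^ (2 ^ (m + 1)) := by rw [← pow_add]; congr 1; ring
    · -- the plain sum
      have h1 := hexp (fun _ => 1) (fun _ => zero_le_one)
      simp only [mul_one] at h1
      refine h1.trans ?_
      have hinner : ∀ a ∈ Ioc 0 N, ∑ b ∈ Ioc 0 (N / a), (b.divisors.card : ℝ) ^ m ≤
          (N : ℝ) / a * (1 + Real.log N) ^ (2 ^ m - 1) := by
        intro a ha
        obtain ⟨ha1, haN⟩ := Finset.mem_Ioc.mp ha
        obtain ⟨-, ihQ⟩ := ih (N / a)
        refine ihQ.trans ?_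
        have hq1 : 1 ≤ N / a := (Nat.one_le_div_iff ha1).mpr haN
        have hqr : ((N / a : ℕ) : ℝ) ≤ (N : ℝ) / a := Nat.cast_div_le
        have hlogle : Real.log ((N / a : ℕ) : ℝ) ≤ Real.log N := by
          apply Real.log_le_log (by exact_mod_cast hq1)
          exact_mod_cast Nat.div_le_self N a
        have hl0 : 0 ≤ 1 + Real.log ((N / a : ℕ) : ℝ) := by
          have : (1 : ℝ) ≤ ((N / a : ℕ) : ℝ) := by exact_mod_cast hq1
          linarith [Real.log_nonneg this]
        exact mul_le_mul hqr (pow_le_pow_left₀ hl0 (by linarith) _) (pow_nonneg hl0 _) (by positivity)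
      calc ∑ a ∈ Ioc 0 N, ∑ b ∈ Ioc 0 (N / a), (a.divisors.card : ℝ) ^ m * (b.divisors.card : ℝ) ^ m
          = ∑ a ∈ Ioc 0 N, (a.divisors.card : ℝ) ^ m * ∑ b ∈ Ioc 0 (N / a), (b.divisors.card : ℝ) ^ m := by
            refine Finset.sum_congr rfl fun a _ => ?_; rw [Finset.mul_sum]
        _ ≤ ∑ a ∈ Ioc 0 N, (a.divisors.card : ℝ) ^ m * ((N : ℝ) / a * (1 + Real.log N) ^ (2 ^ m - 1)) :=
            Finset.sum_le_sum fun a ha => mul_le_mul_of_nonneg_left (hinner a ha) (by positivity)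
        _ = (N : ℝ) * (1 + Real.log N) ^ (2 ^ m - 1) *
              ∑ a ∈ Ioc 0 N, (a.divisors.card : ℝ) ^ m / a := by
            rw [Finset.mul_sum]
            refine Finset.sum_congr rfl fun a ha => ?_
            ring
        _ ≤ (N : ℝ) * (1 + Real.log N) ^ (2 ^ m - 1) * (1 + Real.log N) ^ (2 ^ m) :=
            mul_le_mul_of_nonneg_left ihP (by positivity)
        _ = (N : ℝ) * (1 + Real.log N) ^ (2 ^ (m + 1) - 1) := by
            rw [mul_assoc, ← pow_add]
            congr 2
            have : 1 ≤ 2 ^ m := Nat.one_le_two_pow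
            rw [pow_succ]; omega

/-! ### Hölder -/

/-- **The divisor-weighted mean square via Hölder (exponents `6`, `6/5`)**: for `1/x`-spaced
points, `∑_{1 ≤ n ≤ M} d(n)|S(n)|² ≤ (M(1 + log M)^{63})^{1/6} (R^{2/5} (M + 1 + 2x) R)^{5/6}`.
[folklore] -/
theorem sum_card_divisors_mul_norm_sq_le (T : Finset ι) (θ : ι → ℝ) {x : ℝ} (hx : 0 < x)
    (hsep : ∀ i ∈ T, ∀ j ∈ T, i ≠ j → ∀ k : ℤ, 1 / x ≤ |θ j - θ i - k|) (M : ℕ) :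
    ∑ n ∈ Icc 1 M, ((n.divisors.card : ℝ) * ‖expSum T θ n‖ ^ 2) ≤
      ((M : ℝ) * (1 + Real.log M) ^ (63 : ℕ)) ^ ((1 : ℝ) / 6) *
        (((T.card : ℝ) ^ 2) ^ ((1 : ℝ) / 5) * ((((M : ℝ) + 1 + 2 * x) * T.card))) ^ ((5 : ℝ) / 6) := by
  have hpq : (6 : ℝ).HolderConjugate (6 / 5) := Real.holderConjugate_iff.2 ⟨by norm_num, by norm_num⟩
  have hH := Real.inner_le_Lp_mul_Lq (Icc 1 M) (fun n : ℕ => (n.divisors.card : ℝ))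
    (fun n : ℕ => ‖expSum T θ n‖ ^ 2) hpq
  refine hH.trans ?_
  have hR0 : (0 : ℝ) ≤ T.card := Nat.cast_nonneg _
  -- first factor: the sixth divisor moment
  have h1 : (∑ n ∈ Icc 1 M, |((n.divisors.card : ℝ))| ^ (6 : ℝ)) ≤ (M : ℝ) * (1 + Real.log M) ^ (63 : ℕ) := by
    have := (sum_card_divisors_pow_le_harmonic 6 M).2
    rw [show (2 : ℕ) ^ 6 - 1 = 63 by norm_num] at this
    refine le_trans (le_of_eq ?_) this
    rw [show Icc 1 M = Ioc 0 M by ext n; simp [Finset.mem_Icc, Finset.mem_Ioc]; omega]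
    refine Finset.sum_congr rfl fun n _ => ?_
    rw [abs_of_nonneg (Nat.cast_nonneg _), show (6 : ℝ) = ((6 : ℕ) : ℝ) by norm_num, Real.rpow_natCast]
  -- second factor: `(|S|²)^{6/5} ≤ (R²)^{1/5} |S|²`, then the dual large sieve
  have h2 : (∑ n ∈ Icc 1 M, |‖expSum T θ n‖ ^ 2| ^ ((6 : ℝ) / 5)) ≤
      ((T.card : ℝ) ^ 2) ^ ((1 : ℝ) / 5) * (((M : ℝ) + 1 + 2 * x) * T.card) := by
    have hpt : ∀ n ∈ Icc 1 M, |‖expSum T θ n‖ ^ 2| ^ ((6 : ℝ) / 5) ≤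
        ((T.card : ℝ) ^ 2) ^ ((1 : ℝ) / 5) * ‖expSum T θ n‖ ^ 2 := by
      intro n _
      have h0 : 0 ≤ ‖expSum T θ n‖ ^ 2 := by positivity
      rw [abs_of_nonneg h0, show (6 : ℝ) / 5 = 1 / 5 + 1 by norm_num,
        Real.rpow_add_one' h0 (by norm_num)]
      refine mul_le_mul_of_nonneg_right ?_ h0
      refine Real.rpow_le_rpow h0 ?_ (by norm_num)
      exact pow_le_pow_left₀ (norm_nonneg _) (norm_expSum_le T θ n) 2
    refine (Finset.sum_le_sum hpt).trans ?_
    rw [← Finset.mul_sum]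
    exact mul_le_mul_of_nonneg_left (sum_norm_sq_expSum_le T θ hx hsep M) (by positivity)
  have h1' : (∑ n ∈ Icc 1 M, |((n.divisors.card : ℝ))| ^ (6 : ℝ)) ^ ((1 : ℝ) / 6) ≤
      ((M : ℝ) * (1 + Real.log M) ^ (63 : ℕ)) ^ ((1 : ℝ) / 6) :=
    Real.rpow_le_rpow (Finset.sum_nonneg fun n _ => by positivity) h1 (by norm_num)
  have h2' : (∑ n ∈ Icc 1 M, |‖expSum T θ n‖ ^ 2| ^ ((6 : ℝ) / 5)) ^ ((1 : ℝ) / (6 / 5)) ≤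
      (((T.card : ℝ) ^ 2) ^ ((1 : ℝ) / 5) * (((M : ℝ) + 1 + 2 * x) * T.card)) ^ ((5 : ℝ) / 6) := by
    rw [show (1 : ℝ) / (6 / 5) = 5 / 6 by norm_num]
    exact Real.rpow_le_rpow (Finset.sum_nonneg fun n _ => by positivity) h2 (by norm_num)
  exact mul_le_mul h1' h2' (by positivity) (by positivity)

/-! ### Assembly -/

/-- Iterated sums over `i, j ∈ T`, `0 ≤ a < q` as one sum over the product. [folklore] -/
theorem sum_sum_sum_eq_sum_prod (T : Finset ι) (q : ℕ) (F : ι → ι → ℕ → ℝ) :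
    ∑ i ∈ T, ∑ j ∈ T, ∑ a ∈ range q, F i j a = ∑ σ ∈ (T ×ˢ T) ×ˢ range q, F σ.1.1 σ.1.2 σ.2 := by
  simp only [Finset.sum_product]

/-- **The bound at one dyadic scale.** With `A = M_l` (`1 ≤ A`, `x/2^l/16 ≤ A ≤ x/8`),
`c_l = 8/(2^l A²)`, `R ≥ 1`, and `HB` the Hölder bound of `sum_card_divisors_mul_norm_sq_le`:
`c_l (A Q R² + 2A·HB) ≤ 128 Q R²/x + 768 (1 + log x)^{21/2} R^{7/6}`. [folklore] -/
theorem scale_bound {x A R Q HB : ℝ} {l : ℕ} (hx : 32 ≤ x) (hA1 : 1 ≤ A)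
    (hAlo : x / 2 ^ l / 16 ≤ A) (hAhi : A ≤ x / 8) (hR : 1 ≤ R) (hQ : 0 ≤ Q)
    (hHB : HB ≤ (A * (1 + Real.log A) ^ (63 : ℕ)) ^ ((1 : ℝ) / 6) *
        ((R ^ 2) ^ ((1 : ℝ) / 5) * ((A + 1 + 2 * x) * R)) ^ ((5 : ℝ) / 6)) :
    8 / 2 ^ l / A ^ 2 * (A * Q * R ^ 2 + 2 * A * HB) ≤
      128 * Q * R ^ 2 / x + 768 * (1 + Real.log x) ^ ((21 : ℝ) / 2) * R ^ ((7 : ℝ) / 6) := by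
  have hx0 : 0 < x := by linarith
  have hA0 : 0 < A := by linarith
  have hR0 : 0 < R := by linarith
  have h2l : (0 : ℝ) < 2 ^ l := by positivity
  have hlogx1 : 1 ≤ 1 + Real.log x := by linarith [Real.log_nonneg (by linarith : (1 : ℝ) ≤ x)]
  -- `2^l A ≥ x/16`
  have hlA : x / 16 ≤ 2 ^ l * A := by
    have := mul_le_mul_of_nonneg_left hAlo h2l.le
    rwa [show (2 : ℝ) ^ l * (x / 2 ^ l / 16) = x / 16 by field_simp] at this
  rw [mul_add]
  refine add_le_add ?_ ?_
  · -- `8 Q R²/(2^l A) ≤ 128 Q R²/x`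
    rw [show 8 / 2 ^ l / A ^ 2 * (A * Q * R ^ 2) = 8 * Q * R ^ 2 / (2 ^ l * A) by field_simp]
    rw [div_le_div_iff₀ (by positivity) hx0]
    have : 0 ≤ Q * R ^ 2 := by positivity
    nlinarith
  · -- the Hölder term
    have hlogA : 1 + Real.log A ≤ 1 + Real.log x := by
      linarith [Real.log_le_log hA0 (by linarith : A ≤ x)]
    have hlogA0 : 0 ≤ 1 + Real.log A := by linarith [Real.log_nonneg hA1]
    -- (i) `(A H_A^63)^{1/6} ≤ A^{1/6} (1 + log x)^{21/2}`
    have h1 : (A * (1 + Real.log A) ^ (63 : ℕ)) ^ ((1 : ℝ) / 6) ≤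
        A ^ ((1 : ℝ) / 6) * (1 + Real.log x) ^ ((21 : ℝ) / 2) := by
      rw [Real.mul_rpow hA0.le (by positivity)]
      refine mul_le_mul_of_nonneg_left ?_ (by positivity)
      calc ((1 + Real.log A) ^ (63 : ℕ)) ^ ((1 : ℝ) / 6)
          = (1 + Real.log A) ^ ((21 : ℝ) / 2) := by
            rw [← Real.rpow_natCast, ← Real.rpow_mul hlogA0]; norm_num
        _ ≤ (1 + Real.log x) ^ ((21 : ℝ) / 2) := Real.rpow_le_rpow hlogA0 hlogA (by norm_num)
    -- (ii) `((R²)^{1/5} (A+1+2x) R)^{5/6} ≤ R^{7/6} (3x)^{5/6}`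
    have h2 : ((R ^ 2) ^ ((1 : ℝ) / 5) * ((A + 1 + 2 * x) * R)) ^ ((5 : ℝ) / 6) ≤
        R ^ ((7 : ℝ) / 6) * (3 * x) ^ ((5 : ℝ) / 6) := by
      have hbase : (R ^ 2) ^ ((1 : ℝ) / 5) * ((A + 1 + 2 * x) * R) ≤ R ^ ((7 : ℝ) / 5) * (3 * x) := by
        have hR25 : (R ^ 2) ^ ((1 : ℝ) / 5) = R ^ ((2 : ℝ) / 5) := by
          rw [← Real.rpow_natCast, ← Real.rpow_mul hR0.le]; norm_num
        have hR75 : R ^ ((7 : ℝ) / 5) = R ^ ((2 : ℝ) / 5) * R := by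
          rw [show (7 : ℝ) / 5 = 2 / 5 + 1 by norm_num, Real.rpow_add hR0, Real.rpow_one]
        rw [hR25, hR75]
        have h3x : A + 1 + 2 * x ≤ 3 * x := by linarith
        calc R ^ ((2 : ℝ) / 5) * ((A + 1 + 2 * x) * R) = R ^ ((2 : ℝ) / 5) * R * (A + 1 + 2 * x) := by ring
          _ ≤ R ^ ((2 : ℝ) / 5) * R * (3 * x) := mul_le_mul_of_nonneg_left h3x (by positivity)
      calc ((R ^ 2) ^ ((1 : ℝ) / 5) * ((A + 1 + 2 * x) * R)) ^ ((5 : ℝ) / 6)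
          ≤ (R ^ ((7 : ℝ) / 5) * (3 * x)) ^ ((5 : ℝ) / 6) :=
            Real.rpow_le_rpow (by positivity) hbase (by norm_num)
        _ = R ^ ((7 : ℝ) / 6) * (3 * x) ^ ((5 : ℝ) / 6) := by
            rw [Real.mul_rpow (by positivity) (by positivity), ← Real.rpow_mul hR0.le]; norm_num
    -- (iii) `A^{1/6} (3x)^{5/6} = A (3x/A)^{5/6} ≤ A (3x/A) ≤ A · 48 · 2^l`
    have h3 : A ^ ((1 : ℝ) / 6) * (3 * x) ^ ((5 : ℝ) / 6) ≤ A * (48 * 2 ^ l) := by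
      have hq : (3 * x / A) ^ ((5 : ℝ) / 6) ≤ 3 * x / A := by
        have h1le : (1 : ℝ) ≤ 3 * x / A := by rw [le_div_iff₀ hA0]; linarith
        calc (3 * x / A) ^ ((5 : ℝ) / 6) ≤ (3 * x / A) ^ (1 : ℝ) :=
              Real.rpow_le_rpow_of_exponent_le h1le (by norm_num)
          _ = 3 * x / A := Real.rpow_one _
      have hq2 : 3 * x / A ≤ 48 * 2 ^ l := by
        rw [div_le_iff₀ hA0]; nlinarith
      have heq : A ^ ((1 : ℝ) / 6) * (3 * x) ^ ((5 : ℝ) / 6) = A * (3 * x / A) ^ ((5 : ℝ) / 6) := by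
        rw [Real.div_rpow (by positivity) hA0.le]
        have hA' : A ^ ((1 : ℝ) / 6) * A ^ ((5 : ℝ) / 6) = A := by
          rw [← Real.rpow_add hA0]; norm_num
        have hA56 : A ^ ((5 : ℝ) / 6) ≠ 0 := (Real.rpow_pos_of_pos hA0 _).ne'
        calc A ^ ((1 : ℝ) / 6) * (3 * x) ^ ((5 : ℝ) / 6)
            = A ^ ((1 : ℝ) / 6) * (A ^ ((5 : ℝ) / 6) * (3 * x) ^ ((5 : ℝ) / 6) / A ^ ((5 : ℝ) / 6)) := by
              rw [mul_div_cancel_left₀ _ hA56]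
          _ = (A ^ ((1 : ℝ) / 6) * A ^ ((5 : ℝ) / 6)) * ((3 * x) ^ ((5 : ℝ) / 6) / A ^ ((5 : ℝ) / 6)) := by
              ring
          _ = A * ((3 * x) ^ ((5 : ℝ) / 6) / A ^ ((5 : ℝ) / 6)) := by rw [hA']
      rw [heq]
      exact mul_le_mul_of_nonneg_left (hq.trans hq2) hA0.le
    -- assemble: `c_l · 2A · HB ≤ 16/(2^l A) · A^{1/6}(1+log x)^{21/2} R^{7/6}(3x)^{5/6}`
    have hHB' : HB ≤ (A ^ ((1 : ℝ) / 6) * (1 + Real.log x) ^ ((21 : ℝ) / 2)) *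
        (R ^ ((7 : ℝ) / 6) * (3 * x) ^ ((5 : ℝ) / 6)) :=
      hHB.trans (mul_le_mul h1 h2 (by positivity) (by positivity))
    have hHB0 : HB ≤ (1 + Real.log x) ^ ((21 : ℝ) / 2) * R ^ ((7 : ℝ) / 6) * (A * (48 * 2 ^ l)) := by
      refine hHB'.trans ?_
      calc (A ^ ((1 : ℝ) / 6) * (1 + Real.log x) ^ ((21 : ℝ) / 2)) * (R ^ ((7 : ℝ) / 6) * (3 * x) ^ ((5 : ℝ) / 6))
          = (1 + Real.log x) ^ ((21 : ℝ) / 2) * R ^ ((7 : ℝ) / 6) * (A ^ ((1 : ℝ) / 6) * (3 * x) ^ ((5 : ℝ) / 6)) := by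
            ring
        _ ≤ _ := mul_le_mul_of_nonneg_left h3 (by positivity)
    calc 8 / 2 ^ l / A ^ 2 * (2 * A * HB) = 16 / (2 ^ l * A) * HB := by field_simp; ring
      _ ≤ 16 / (2 ^ l * A) * ((1 + Real.log x) ^ ((21 : ℝ) / 2) * R ^ ((7 : ℝ) / 6) * (A * (48 * 2 ^ l))) := by
          refine mul_le_mul_of_nonneg_left hHB0 (by positivity)
      _ = 768 * (1 + Real.log x) ^ ((21 : ℝ) / 2) * R ^ ((7 : ℝ) / 6) := by field_simp; ring

/-- **Pairs of well-spaced points at major-arc differences (log-loss form of Bourgain's lemma).**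
Let `x ≥ 32`, let `θ_i` (`i ∈ T`, `R = #T`) satisfy `|θ_j − θ_i − k| ≥ 1/x` for `i ≠ j` and all
integers `k`, and let `Q` be arbitrary. Then
`∑_{i,j ∈ T} G(θ_i − θ_j) ≤ 1200 (1 + log x)^{23/2} R^{7/6} + 250 (1 + log x) Q R²/x`,
where `G(θ) = ∑_{q ≤ Q} ∑_{0 ≤ a < q} q⁻¹ (1 + x‖θ − a/q‖)⁻¹`. (Harper/Bourgain: `≪ R Q^ε log x +
R² Q log x/x + R² log x/Q^A`; the loss `R^{1/6} (log x)^{O(1)}` in place of `Q^ε` is harmless for the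
large-values estimate behind Harper's Theorem 2 in its log-lossy form.)
[cite: Harper2016, §2.3 (Harmonic Analysis Result 2)] -/
theorem sum_sum_majorArcWeight_le {x : ℝ} (hx : 32 ≤ x) (T : Finset ι) (θ : ι → ℝ)
    (hsep : ∀ i ∈ T, ∀ j ∈ T, i ≠ j → ∀ k : ℤ, 1 / x ≤ |θ j - θ i - k|) (Q : ℕ) :
    ∑ i ∈ T, ∑ j ∈ T, majorArcWeight Q x (θ i - θ j) ≤
      1200 * (1 + Real.log x) ^ ((23 : ℝ) / 2) * (T.card : ℝ) ^ ((7 : ℝ) / 6) +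
        250 * (1 + Real.log x) * Q * (T.card : ℝ) ^ 2 / x := by
  classical
  have hx0 : 0 < x := by linarith
  have hx1 : 1 ≤ x := by linarith
  have hlogx : 0 ≤ Real.log x := Real.log_nonneg hx1
  -- the empty family
  rcases T.eq_empty_or_nonempty with hT | hT
  · subst hT; simp
  set R : ℝ := (T.card : ℝ) with hR
  have hR1 : 1 ≤ R := by
    rw [hR]; exact_mod_cast Finset.card_pos.mpr hT
  have hR0 : 0 ≤ R := by linarith
  obtain ⟨J, hJlo, hJhi, hJlog⟩ := exists_dyadic_range hx
  -- abbreviations for the scales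
  set Ml : ℕ → ℕ := fun l => scaleLen x l with hMl
  set c : ℕ → ℝ := fun l => 8 / 2 ^ l / (Ml l : ℝ) ^ 2 with hc
  have hc0 : ∀ l, 0 ≤ c l := fun l => by simp only [hc]; positivity
  have hscale : ∀ l ∈ range (J + 1), 16 ≤ x / 2 ^ l := by
    intro l hl
    rw [Finset.mem_range] at hl
    rw [le_div_iff₀ (by positivity)]
    calc 16 * (2 : ℝ) ^ l ≤ 16 * 2 ^ J := by gcongr; norm_num; omega
      _ ≤ x := by rw [← le_div_iff₀' (by norm_num : (0 : ℝ) < 16)]; exact hJhi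
  -- the kernel sums at each scale
  set Kl : ℕ → ℝ := fun l => ∑ q ∈ Icc 1 Q, ∑ σ ∈ (T ×ˢ T) ×ˢ range q,
    (1 / (q : ℝ)) * ‖dirichlet (Ml l) (θ σ.1.1 - θ σ.1.2 - (σ.2 : ℝ) / q)‖ ^ 2 with hKl
  ------------------------------------------------------------------
  -- Step 1: reindex and apply the pointwise majorant
  have hreidx : ∑ i ∈ T, ∑ j ∈ T, majorArcWeight Q x (θ i - θ j) =
      ∑ q ∈ Icc 1 Q, ∑ σ ∈ (T ×ˢ T) ×ˢ range q,
        (1 / (q : ℝ)) * arcWeight x (θ σ.1.1 - θ σ.1.2 - (σ.2 : ℝ) / q) := by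
    unfold majorArcWeight
    calc ∑ i ∈ T, ∑ j ∈ T, ∑ q ∈ Icc 1 Q, ∑ a ∈ range q, (1 / (q : ℝ)) * arcWeight x (θ i - θ j - a / q)
        = ∑ i ∈ T, ∑ q ∈ Icc 1 Q, ∑ j ∈ T, ∑ a ∈ range q, (1 / (q : ℝ)) * arcWeight x (θ i - θ j - a / q) :=
          Finset.sum_congr rfl fun i _ => Finset.sum_comm
      _ = ∑ q ∈ Icc 1 Q, ∑ i ∈ T, ∑ j ∈ T, ∑ a ∈ range q, (1 / (q : ℝ)) * arcWeight x (θ i - θ j - a / q) :=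
          Finset.sum_comm
      _ = _ := Finset.sum_congr rfl fun q _ =>
          sum_sum_sum_eq_sum_prod T q (fun i j a => (1 / (q : ℝ)) * arcWeight x (θ i - θ j - a / q))
  have hstep1 : ∑ i ∈ T, ∑ j ∈ T, majorArcWeight Q x (θ i - θ j) ≤
      ∑ l ∈ range (J + 1), c l * Kl l + 32 * Q * R ^ 2 / x := by
    rw [hreidx]
    -- pointwise bound
    have hpt : ∀ (q : ℕ) (t : ℝ), (1 / (q : ℝ)) * arcWeight x t ≤
        ∑ l ∈ range (J + 1), c l * ((1 / (q : ℝ)) * ‖dirichlet (Ml l) t‖ ^ 2) + (1 / (q : ℝ)) * (32 / x) := by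
      intro q t
      have h := arcWeight_le_dyadic hx hJlo hJhi t
      have hq0 : (0 : ℝ) ≤ 1 / q := by positivity
      calc (1 / (q : ℝ)) * arcWeight x t
          ≤ (1 / (q : ℝ)) * (∑ l ∈ range (J + 1), (8 / 2 ^ l / (scaleLen x l : ℝ) ^ 2) *
              ‖dirichlet (scaleLen x l) t‖ ^ 2 + 32 / x) := mul_le_mul_of_nonneg_left h hq0
        _ = _ := by
            rw [mul_add, Finset.mul_sum]
            congr 1
            refine Finset.sum_congr rfl fun l _ => ?_
            simp only [hc, hMl]; ring
    calc ∑ q ∈ Icc 1 Q, ∑ σ ∈ (T ×ˢ T) ×ˢ range q,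
          (1 / (q : ℝ)) * arcWeight x (θ σ.1.1 - θ σ.1.2 - (σ.2 : ℝ) / q)
        ≤ ∑ q ∈ Icc 1 Q, ∑ σ ∈ (T ×ˢ T) ×ˢ range q,
          (∑ l ∈ range (J + 1), c l * ((1 / (q : ℝ)) * ‖dirichlet (Ml l) (θ σ.1.1 - θ σ.1.2 - (σ.2 : ℝ) / q)‖ ^ 2) +
            (1 / (q : ℝ)) * (32 / x)) :=
          Finset.sum_le_sum fun q _ => Finset.sum_le_sum fun σ _ => hpt q _
      _ = ∑ q ∈ Icc 1 Q, ∑ σ ∈ (T ×ˢ T) ×ˢ range q,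
            ∑ l ∈ range (J + 1), c l * ((1 / (q : ℝ)) * ‖dirichlet (Ml l) (θ σ.1.1 - θ σ.1.2 - (σ.2 : ℝ) / q)‖ ^ 2) +
          ∑ q ∈ Icc 1 Q, ∑ σ ∈ (T ×ˢ T) ×ˢ range q, (1 / (q : ℝ)) * (32 / x) := by
          rw [← Finset.sum_add_distrib]
          refine Finset.sum_congr rfl fun q _ => ?_
          rw [Finset.sum_add_distrib]
      _ = ∑ l ∈ range (J + 1), c l * Kl l + 32 * Q * R ^ 2 / x := by
          congr 1
          · -- reorder to `∑_l c_l K_l`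
            calc ∑ q ∈ Icc 1 Q, ∑ σ ∈ (T ×ˢ T) ×ˢ range q, ∑ l ∈ range (J + 1),
                  c l * ((1 / (q : ℝ)) * ‖dirichlet (Ml l) (θ σ.1.1 - θ σ.1.2 - (σ.2 : ℝ) / q)‖ ^ 2)
                = ∑ q ∈ Icc 1 Q, ∑ l ∈ range (J + 1), ∑ σ ∈ (T ×ˢ T) ×ˢ range q,
                  c l * ((1 / (q : ℝ)) * ‖dirichlet (Ml l) (θ σ.1.1 - θ σ.1.2 - (σ.2 : ℝ) / q)‖ ^ 2) :=
                  Finset.sum_congr rfl fun q _ => Finset.sum_comm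
              _ = ∑ l ∈ range (J + 1), ∑ q ∈ Icc 1 Q, ∑ σ ∈ (T ×ˢ T) ×ˢ range q,
                  c l * ((1 / (q : ℝ)) * ‖dirichlet (Ml l) (θ σ.1.1 - θ σ.1.2 - (σ.2 : ℝ) / q)‖ ^ 2) :=
                  Finset.sum_comm
              _ = _ := by
                  refine Finset.sum_congr rfl fun l _ => ?_
                  simp only [hKl, Finset.mul_sum]
          · -- the constant term
            have hin : ∀ q ∈ Icc 1 Q, ∑ σ ∈ (T ×ˢ T) ×ˢ range q, (1 / (q : ℝ)) * (32 / x) = 32 * R ^ 2 / x := by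
              intro q hq
              rw [Finset.mem_Icc] at hq
              have hq0 : (q : ℝ) ≠ 0 := by have : 1 ≤ q := hq.1; positivity
              rw [Finset.sum_const, Finset.card_product, Finset.card_product, Finset.card_range,
                nsmul_eq_mul]
              push_cast
              rw [hR]; field_simp
            rw [Finset.sum_congr rfl hin, Finset.sum_const, Nat.card_Icc, nsmul_eq_mul]
            push_cast
            ring
  ------------------------------------------------------------------
  -- Step 2: the kernel sum at scale `l`
  have hstep2 : ∀ l ∈ range (J + 1), c l * Kl l ≤
      128 * Q * R ^ 2 / x + 768 * (1 + Real.log x) ^ ((21 : ℝ) / 2) * R ^ ((7 : ℝ) / 6) := by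
    intro l hl
    obtain ⟨hM1, hMlo⟩ := le_scaleLen (hscale l hl)
    have hMhi := scaleLen_le x hx0.le l
    set A : ℝ := (Ml l : ℝ) with hA
    have hA1 : (1 : ℝ) ≤ A := by rw [hA, hMl]; exact_mod_cast hM1
    have hAlo : x / 2 ^ l / 16 ≤ A := by rw [hA, hMl]; exact hMlo
    have hAhi : A ≤ x / 8 := by
      have h1 : x / 2 ^ l ≤ x := div_le_self hx0.le (one_le_pow₀ (by norm_num))
      have h2 : x / 2 ^ l / 8 ≤ x / 8 := div_le_div_of_nonneg_right h1 (by norm_num)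
      exact hMhi.trans h2
    -- `K_l = ∑_μ d_Q |S|² ≤ A Q R² + 2A ∑ d(n)|S(n)|²`
    have hK : Kl l ≤ A * Q * R ^ 2 + 2 * A * ∑ n ∈ Icc 1 (Ml l),
        ((n.divisors.card : ℝ) * ‖expSum T θ n‖ ^ 2) := by
      simp only [hKl]
      rw [sum_sum_kernel_eq_divCount T θ Q (Ml l)]
      exact sum_divCount_mul_le T θ Q (Ml l)
    have hHB := sum_card_divisors_mul_norm_sq_le T θ hx0 hsep (Ml l)
    calc c l * Kl l ≤ c l * (A * Q * R ^ 2 + 2 * A * ∑ n ∈ Icc 1 (Ml l),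
          ((n.divisors.card : ℝ) * ‖expSum T θ n‖ ^ 2)) := mul_le_mul_of_nonneg_left hK (hc0 l)
      _ ≤ _ := scale_bound hx hA1 hAlo hAhi hR1 (Nat.cast_nonneg Q) hHB
  ------------------------------------------------------------------
  -- Step 3: sum over the `J + 1 ≤ log x/log 2 + 1` scales
  have hJ1 : ((J : ℝ) + 1) ≤ Real.log x / Real.log 2 + 1 := by linarith
  have hlog2 : Real.log x / Real.log 2 ≤ 3 / 2 * Real.log x := by
    rw [div_le_iff₀ (Real.log_pos (by norm_num))]
    have := Real.log_two_gt_d9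
    nlinarith
  have hsum : ∑ l ∈ range (J + 1), c l * Kl l ≤
      ((J : ℝ) + 1) * (128 * Q * R ^ 2 / x + 768 * (1 + Real.log x) ^ ((21 : ℝ) / 2) * R ^ ((7 : ℝ) / 6)) := by
    calc ∑ l ∈ range (J + 1), c l * Kl l
        ≤ ∑ l ∈ range (J + 1), (128 * Q * R ^ 2 / x + 768 * (1 + Real.log x) ^ ((21 : ℝ) / 2) * R ^ ((7 : ℝ) / 6)) :=
          Finset.sum_le_sum hstep2
      _ = _ := by rw [Finset.sum_const, Finset.card_range, nsmul_eq_mul]; push_cast; ring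
  have hpow : (1 + Real.log x) ^ ((23 : ℝ) / 2) = (1 + Real.log x) * (1 + Real.log x) ^ ((21 : ℝ) / 2) := by
    rw [show (23 : ℝ) / 2 = 1 + 21 / 2 by norm_num, Real.rpow_add (by linarith), Real.rpow_one]
  have hQR : 0 ≤ (Q : ℝ) * R ^ 2 / x := by positivity
  have hP : 0 ≤ (1 + Real.log x) ^ ((21 : ℝ) / 2) * R ^ ((7 : ℝ) / 6) := by positivity
  refine (hstep1.trans (add_le_add hsum le_rfl)).trans ?_
  rw [hpow]
  set L : ℝ := 1 + Real.log x with hL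
  set P : ℝ := (1 + Real.log x) ^ ((21 : ℝ) / 2) * R ^ ((7 : ℝ) / 6) with hPdef
  set W : ℝ := (Q : ℝ) * R ^ 2 / x with hW
  have hL1 : 1 ≤ L := by rw [hL]; linarith
  have hJ3 : (J : ℝ) + 1 ≤ 3 / 2 * L := by rw [hL]; linarith
  have h1 : ((J : ℝ) + 1) * (128 * W) ≤ (3 / 2 * L) * (128 * W) :=
    mul_le_mul_of_nonneg_right hJ3 (by positivity)
  have h2 : ((J : ℝ) + 1) * (768 * P) ≤ (3 / 2 * L) * (768 * P) :=
    mul_le_mul_of_nonneg_right hJ3 (by positivity)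
  have h3 : 32 * W ≤ 32 * L * W := by nlinarith
  have hlhs : ((J : ℝ) + 1) * (128 * (Q : ℝ) * R ^ 2 / x + 768 * (1 + Real.log x) ^ ((21 : ℝ) / 2) * R ^ ((7 : ℝ) / 6)) +
      32 * (Q : ℝ) * R ^ 2 / x = ((J : ℝ) + 1) * (128 * W) + ((J : ℝ) + 1) * (768 * P) + 32 * W := by
    simp only [hW, hPdef]; ring
  have hrhs : 1200 * ((1 + Real.log x) * (1 + Real.log x) ^ ((21 : ℝ) / 2)) * R ^ ((7 : ℝ) / 6) +
      250 * (1 + Real.log x) * (Q : ℝ) * R ^ 2 / x = 1200 * L * P + 250 * L * W := by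
    simp only [hW, hPdef, hL]; ring
  have h4 : 0 ≤ L * W := by positivity
  have h5 : 0 ≤ L * P := by positivity
  rw [hlhs, hrhs]
  nlinarith [h1, h2, h3, h4, h5]

end BourgainSpacing

end Literature.NumberTheory.Sieve

end
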